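import Literature.RingTheory.MvPowerSeries.HasseDerivFrobenius
import Mathlib.Algebra.CharP.Lemmas
import Mathlib.Data.Nat.Choose.Lucas
import HarnessLib

/-!
# Divided (Hasse) derivatives commute with the Frobenius: `Δ_{p^N γ}(G^{p^N}) = (Δ_γ G)^{p^N}`

Topic: `Literature/RingTheory/MvPowerSeries`. For the divided partial derivatives `Δ_α = hasseDeriv α` of
`A⟦X_τ⟧` (`AdicTaylor.lean`), `A` a commutative ring of PRIME characteristic `p`, `τ` finite:

* `hasseDeriv_pow_char_pow_eq_zero_of_not_dvd` — `Δ_β (G^{p^N}) = 0` as soon as some coordinate `β_s` is NOT a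
  multiple of `p^N`;
* `hasseDeriv_smul_pow_char_pow` — `Δ_{p^N • γ} (G^{p^N}) = (Δ_γ G)^{p^N}` for every multi-order `γ`.

Both are the coefficientwise content of the fact that the Taylor homomorphism `G ↦ G(X + Y) = Σ_α Δ_α(G) Y^α` is a
RING homomorphism (Matsumura, *Commutative Ring Theory*, §27: a higher derivation `(D_0, D_1, …)` is the same as
the ring homomorphism `E_t = Σ D_n t^n`), so that in characteristic `p`:
`Σ_β Δ_β(G^{p^N}) Y^β = (Σ_γ Δ_γ(G) Y^γ)^{p^N} = Σ_γ Δ_γ(G)^{p^N} Y^{p^N γ}`. The proof here is the direct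
coefficient computation: `coeff_{p^N m}(G^{p^N}) = (coeff_m G)^{p^N}` and `coeff_e (G^{p^N}) = 0` off the lattice
`p^N ℕ^τ` (`FrobeniusPowerBasis.lean`, from Mathlib's `map_iterateFrobenius_expand`), together with two digits of
Lucas' theorem: `p ∣ C(p^N m, k)` when `p^N ∤ k`, and `C(p^N a, p^N b) ≡ C(a, b) (mod p)`.

This is the identity the manuscript [Hironaka2017] prints at p.31 l.9 («∂(ℓ)(ρ^ℓ(X)) = ρ^ℓ(∂^α X) for every
X ∈ O», `∂(ℓ) = ∂^{(p^ℓ α)}`, `ρ` the Frobenius) and uses for Eq. (47); the consumer is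
`Literature/AlgebraicGeometry/Hironaka2017/Proofs/S06BaseHike/U31L8.lean`. Deliberately NOT here: anything about
orders or maximal ideals (see `HasseDerivOrder.lean`, `MaximalIdealPow.lean`).

## Sources
* H. Matsumura, *Commutative Ring Theory* (1986), §27 (higher derivations ⟷ ring homomorphisms `E_t`; hence
  `E_t(a^p) = E_t(a)^p`). [Matsumura1987]
* C. Abad, J. Algebra 523 (2019), Lemma 6.2 and its proof (Lucas-type arithmetic of `C(·,·)` modulo `p` behind the
  behaviour of `Δ_α` on `p^e`-th powers). [Abad2019pBases]
-/

noncomputable section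

open _root_.MvPowerSeries

namespace Literature.RingTheory.MvPowerSeries

universe u v

/-! ## Two digits of Lucas' theorem -/

/-- `p ∣ C(p^N · m, k)` whenever `p^N ∤ k` (prime `p`): iterate Lucas' congruence
`C(n, k) ≡ C(n mod p, k mod p) · C(n / p, k / p)`; the lowest nonzero base-`p` digit of `k` below position `N`
faces a zero digit of `p^N m`. [cite: Abad2019pBases, Lemma 6.2 (arithmetic behind p^e-linearity)] -/
theorem dvd_choose_pow_mul_of_not_dvd {p : ℕ} (hp : p.Prime) :
    ∀ {N m k : ℕ}, ¬ p ^ N ∣ k → p ∣ (p ^ N * m).choose k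
  | 0, m, k, h => absurd (one_dvd k) (by rw [pow_zero] at h; exact h)
  | N + 1, m, k, h => by
    haveI := Fact.mk hp
    have luc := Choose.choose_modEq_choose_mod_mul_choose_div_nat (n := p ^ (N + 1) * m) (k := k) (p := p)
    have hmod : p ^ (N + 1) * m % p = 0 := by
      rw [pow_succ', mul_assoc]; exact Nat.mul_mod_right p _
    have hdiv : p ^ (N + 1) * m / p = p ^ N * m := by
      rw [pow_succ', mul_assoc, Nat.mul_div_cancel_left _ hp.pos]
    rw [hmod, hdiv] at luc
    by_cases hk : p ∣ k
    · obtain ⟨k', rfl⟩ := hk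
      have hk' : ¬ p ^ N ∣ k' := fun h' => h (by rw [pow_succ']; exact Nat.mul_dvd_mul_left p h')
      rw [Nat.mul_mod_right, Nat.choose_zero_right, one_mul, Nat.mul_div_cancel_left _ hp.pos] at luc
      rw [Nat.dvd_iff_mod_eq_zero, luc, ← Nat.dvd_iff_mod_eq_zero]
      exact dvd_choose_pow_mul_of_not_dvd hp hk'
    · have hkp : 0 < k % p := Nat.pos_of_ne_zero fun h0 => hk (Nat.dvd_of_mod_eq_zero h0)
      rw [Nat.choose_eq_zero_of_lt hkp, zero_mul] at luc
      exact Nat.dvd_of_mod_eq_zero luc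

/-- `C(p^N · a, p^N · b) ≡ C(a, b) (mod p)` (prime `p`): iterate Lucas' congruence; the `N` lowest base-`p` digits of
both arguments vanish. [cite: Abad2019pBases, Lemma 6.2 (arithmetic behind p^e-linearity)] -/
theorem choose_pow_mul_modEq {p : ℕ} (hp : p.Prime) :
    ∀ (N a b : ℕ), (p ^ N * a).choose (p ^ N * b) ≡ a.choose b [MOD p]
  | 0, a, b => by simp [Nat.ModEq.refl]
  | N + 1, a, b => by
    haveI := Fact.mk hp
    have luc := Choose.choose_modEq_choose_mod_mul_choose_div_nat (n := p ^ (N + 1) * a) (k := p ^ (N + 1) * b)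
      (p := p)
    have hmod : ∀ c : ℕ, p ^ (N + 1) * c % p = 0 := fun c => by
      rw [pow_succ', mul_assoc]; exact Nat.mul_mod_right p _
    have hdiv : ∀ c : ℕ, p ^ (N + 1) * c / p = p ^ N * c := fun c => by
      rw [pow_succ', mul_assoc, Nat.mul_div_cancel_left _ hp.pos]
    rw [hmod, hmod, hdiv, hdiv, Nat.choose_zero_right, one_mul] at luc
    exact luc.trans (choose_pow_mul_modEq hp N a b)

/-! ## Frobenius compatibility of the divided derivatives -/

section Frobenius

variable {τ : Type v} {A : Type u} [CommRing A] [Fintype τ] (p : ℕ) [hp : Fact p.Prime] [CharP A p]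

/-- In characteristic `p`, natural-number casts are fixed by the `p^N`-th power map. [folklore] -/
private theorem natCast_pow_char_pow (c N : ℕ) : ((c : A)) ^ p ^ N = (c : A) := by
  rw [← iterateFrobenius_def, map_natCast]

omit [Fintype τ] hp in
/-- The coordinates of `p^N • γ`. [folklore] -/
private theorem smul_apply' (N : ℕ) (γ : τ →₀ ℕ) (s : τ) : (p ^ N • γ) s = p ^ N * γ s := by
  rw [Finsupp.smul_apply, smul_eq_mul]

/-- **`Δ_β (G^{p^N}) = 0` when some coordinate of `β` is not a multiple of `p^N`** (prime characteristic `p`,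
finitely many variables): coefficientwise, `coeff_δ Δ_β(G^{p^N}) = C(β+δ, β) · coeff_{β+δ}(G^{p^N})`; either `β + δ`
leaves the lattice `p^N ℕ^τ`, where `G^{p^N}` has no coefficients, or `β + δ = p^N m` and then `p ∣ C(p^N m_s, β_s)`
at the offending coordinate. Consequence of the Taylor homomorphism being a ring map (`E_t(a^{p^N}) = E_t(a)^{p^N}`).
[cite: Matsumura1987, §27 (higher derivations as ring homomorphisms E_t)] -/
theorem hasseDeriv_pow_char_pow_eq_zero_of_not_dvd {N : ℕ} {β : τ →₀ ℕ} (hβ : ∃ s, ¬ p ^ N ∣ β s)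
    (G : MvPowerSeries τ A) : hasseDeriv β (G ^ p ^ N) = 0 := by
  haveI : ExpChar A p := ExpChar.prime hp.out
  ext δ
  rw [coeff_hasseDeriv, map_zero]
  by_cases hdiv : ∀ s, p ^ N ∣ (β + δ) s
  · obtain ⟨s, hs⟩ := hβ
    obtain ⟨m, hm⟩ := hdiv s
    have hzero : (((β + δ).prod fun s n => n.choose (β s) : ℕ) : A) = 0 := by
      rw [prod_choose_eq, Nat.cast_prod]
      refine Finset.prod_eq_zero (Finset.mem_univ s) ?_
      rw [← Finsupp.add_apply, hm]
      exact (CharP.cast_eq_zero_iff A p _).mpr (dvd_choose_pow_mul_of_not_dvd hp.out hs)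
    rw [hzero, zero_mul]
  · push Not at hdiv
    rw [isSupportedOnMultiples_pow p G N (β + δ) hdiv, mul_zero]

/-- **`Δ_{p^N • γ} (G^{p^N}) = (Δ_γ G)^{p^N}`** (prime characteristic `p`, finitely many variables): the divided
derivatives commute with the Frobenius in the graded sense — the coefficientwise content of
`E_t(G^{p^N}) = E_t(G)^{p^N}` for the Taylor ring homomorphism `E_t = Σ_α Δ_α t^α`. On the lattice
`δ = p^N δ'`: `coeff (G^{p^N})_{p^N(γ+δ')} = (coeff G_{γ+δ'})^{p^N}`, `C(p^N(γ+δ'), p^N γ) ≡ C(γ+δ', γ)` (Lucas) and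
`c^{p^N} = c` for `c ∈ 𝔽_p`; off the lattice both sides have no coefficients.
[cite: Matsumura1987, §27 (higher derivations as ring homomorphisms E_t)] -/
theorem hasseDeriv_smul_pow_char_pow (N : ℕ) (γ : τ →₀ ℕ) (G : MvPowerSeries τ A) :
    hasseDeriv (p ^ N • γ) (G ^ p ^ N) = (hasseDeriv γ G) ^ p ^ N := by
  haveI : ExpChar A p := ExpChar.prime hp.out
  ext δ
  by_cases hδ : ∀ s, p ^ N ∣ δ s
  · -- on the lattice: `δ = p^N • δ'`
    set δ' : τ →₀ ℕ := Finsupp.mapRange (fun x => x / p ^ N) (Nat.zero_div _) δ with hδ'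
    have hδeq : δ = p ^ N • δ' := eq_smul_mapRange_div_of_forall_dvd hδ
    rw [hδeq, coeff_smul_pow_pow p (hasseDeriv γ G) N δ', coeff_hasseDeriv, coeff_hasseDeriv, prod_choose_eq,
      prod_choose_eq, ← smul_add, coeff_smul_pow_pow p G N (γ + δ'), mul_pow, natCast_pow_char_pow p]
    congr 1
    rw [Nat.cast_prod, Nat.cast_prod]
    refine Finset.prod_congr rfl fun s _ => ?_
    rw [smul_apply', smul_apply', ← mul_add]
    exact (CharP.natCast_eq_natCast' A p) (choose_pow_mul_modEq hp.out N _ _)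
  · -- off the lattice: both sides vanish
    push Not at hδ
    obtain ⟨s, hs⟩ := hδ
    have hR : coeff δ ((hasseDeriv γ G) ^ p ^ N) = 0 :=
      isSupportedOnMultiples_pow p (hasseDeriv γ G) N δ ⟨s, hs⟩
    have hL : coeff (p ^ N • γ + δ) (G ^ p ^ N) = 0 := by
      refine isSupportedOnMultiples_pow p G N _ ⟨s, fun h => hs ?_⟩
      rw [Finsupp.add_apply, smul_apply'] at h
      exact (Nat.dvd_add_right (Dvd.intro _ rfl)).mp h
    rw [hR, coeff_hasseDeriv, hL, mul_zero]

end Frobenius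

end Literature.RingTheory.MvPowerSeries

end
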